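import Literature.MathematicalPhysics.QuantumFieldTheory.Balaban1983to89.T3NontrivialityFromTiltRefine
import Literature.MathematicalPhysics.QuantumFieldTheory.Balaban1983to89.T3CentreSymmetry
import HarnessLib

/-!
# `Balaban1983to89.T3NontrivialityFromTiltLabels` — (NT3) from the unit-scale tilt for EVERY LABEL THAT VISITS SOME BOND EXACTLY ONCE
# (all simple loops: plaquettes, Polyakov lines, …), for the original and the refined family

Cell `ym3-torus` (HUMAN RULING D-0037, YM ladder rung R3), seat `ym3-torus-p2` gen 15; companion of `T3NontrivialityFromTilt` /
`T3NontrivialityFromTiltRefine` (same gen).  WHAT THIS IS NOT: not d = 4, not infinite volume, not a mass gap, not Clay; `UnitTiltTail`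
(K1 ∧ K2) stays an OPEN hypothesis; `SU(2)` and the printed averaging throughout.

THE ONE OBSERVATION.  If a step list `γ = γ₁ ++ s :: γ₂` visits the bond of `s` only at `s`, the loop variable `reTr 𝒰(γ)` is ONE-LINK
QUATERNION-AFFINE through that bond with a UNIT datum: `𝒰(γ)(u[b ↦ g]) = A·g^{±1}·B` with `A = 𝒰(γ₁)(u)`, `B = 𝒰(γ₂)(u)` free of `b`, and
`reTr(A g B) = Re(su2Quat g · q(B)q(A))` (`T4GnomonicWilsonHessian.reTr_conj_link`), `reTr(A g⁻¹ B) = Re(su2Quat g · (q(B)q(A))*)`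
(`T4WilsonLinkAffine.re_star_mul`).  Hence (§1) its level sets are product-Haar-null (`T3NontrivialityFromTilt.fieldMeasure_level_eq_zero_of_linkAffine`),
(§2) its laws under every unit law — and the law of the original family's string read on a refined unit field — have NO ATOMS, and (§3) the
core theorem `variance_eventually_ge_of_unitTiltTail` gives (NT3) for every such label from `UnitTiltTail` with summable rates, for `(F, γ)`
itself and from a refinement `(F.refine n, γL^{-n})`.  §4: the straight POLYAKOV label `ULoop3.polyakov μ x` visits its first bond once
(torus side `2L^m ≥ 2`), so (NT3) holds for it too — gen 6's label, now WITHOUT the small-mass hypothesis.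

References: C. King, CMP 102 (1986) 649–677 [King1986] (Thm 3.4 p.656); S. Chatterjee [Chatterjee2026YMHiggs] (§3.2), [Chatterjee2019YMProbabilists]
(§2, §6 p.19); L. McLerran, B. Svetitsky, Phys. Rev. D 24 (1981) 450 [McLerranSvetitsky1981]; T. Bałaban [Balaban1987RG1] ((0.2)/(0.4)/(0.11) pp.252–253).
-/

noncomputable section

open MeasureTheory Filter Topology Set
open scoped ENNReal Quaternion
open Literature.MathematicalPhysics.QuantumFieldTheory.Balaban1983to89.T3ContinuumYM3Torus
open Literature.MathematicalPhysics.QuantumFieldTheory.Balaban1983to89.T3ThresholdRemoval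
open Literature.MathematicalPhysics.QuantumFieldTheory.Balaban1983to89.T3LevelShift
open Literature.MathematicalPhysics.QuantumFieldTheory.Balaban1983to89.T3UnitScaleTilt
open Literature.MathematicalPhysics.QuantumFieldTheory.Balaban1983to89.T3UnitLawDensityEML (ℰp measurableE_ℰp)
open Literature.MathematicalPhysics.QuantumFieldTheory.Balaban1983to89.T3NontrivialityFromTilt
open Literature.MathematicalPhysics.QuantumFieldTheory.Balaban1983to89.T3NontrivialityFromTiltRefine
open Literature.MathematicalPhysics.QuantumFieldTheory.Balaban1983to89.T4Continuum
open Literature.MathematicalPhysics.QuantumFieldTheory.Balaban1983to89.T4CubeChartGnomonic (SU2)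
open Literature.MathematicalPhysics.QuantumLattice (su2Quat norm_su2Quat)
open Literature.MathematicalPhysics.QuantumFieldTheory.Balaban1983to89.T4HaarSU2Translate (su2Quat_mul)
open Literature.MathematicalPhysics.QuantumFieldTheory.Balaban1983to89.T4GnomonicWilsonHessian (LinkAffine reTr_conj_link)
open Literature.MathematicalPhysics.QuantumFieldTheory.Balaban1983to89.T4WilsonLinkAffine (su2Quat_inv re_star_mul)

namespace Literature.MathematicalPhysics.QuantumFieldTheory.Balaban1983to89.T3NontrivialityFromTiltLabels

/-! ## §1 A once-visited bond makes the loop variable one-link affine with a unit datum -/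

section OnceVisited

variable {P : Params} {j : ℕ}

/-- Holonomy along steps that avoid the bond `b` does not see `U(b)`. [cite: Chatterjee2019YMProbabilists, §2] -/
theorem holAt_update_of_forall_ne [DecidableEq (PBond P j)] (u : GaugeField P j SU2) (b : PBond P j) (g : SU2) :
    ∀ γ : List (LStep P j), (∀ s ∈ γ, s.bond ≠ b) → holAt (Function.update u b g) γ = holAt u γ
  | [], _ => by rw [holAt_nil, holAt_nil]
  | s :: γ, h => by
    have hs : s.bond ≠ b := h s (by simp)
    have hγ : ∀ s' ∈ γ, s'.bond ≠ b := fun s' hs' => h s' (by simp [hs'])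
    rw [holAt_cons, holAt_cons, holAt_update_of_forall_ne u b g γ hγ, Function.update_of_ne hs]

/-- **A ONCE-VISITED BOND ⇒ ONE-LINK AFFINE WITH A UNIT DATUM**: for `γ = γ₁ ++ s :: γ₂` with the bond of `s` absent from `γ₁` and `γ₂`,
`u ↦ reTr 𝒰(γ)(u)` is `LinkAffine` through `s.bond` at every base field, with constant `0` and a datum of norm `1` (`q(B)q(A)` or its conjugate,
`A = 𝒰(γ₁)`, `B = 𝒰(γ₂)`; cyclicity `reTr_conj_link`). [cite: Chatterjee2019YMProbabilists, §2] -/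
theorem linkAffine_reTr_holAt_split [DecidableEq (PBond P j)] (u : GaugeField P j SU2) (γ₁ γ₂ : List (LStep P j)) (s : LStep P j)
    (h₁ : ∀ s' ∈ γ₁, s'.bond ≠ s.bond) (h₂ : ∀ s' ∈ γ₂, s'.bond ≠ s.bond) :
    ∃ a : ℍ, ‖a‖ = 1 ∧ LinkAffine (fun U => GaugeGroup.reTr (holAt U (γ₁ ++ s :: γ₂))) u s.bond 0 a := by
  obtain ⟨b, f⟩ := s
  set A : SU2 := holAt u γ₁ with hA_def
  set B : SU2 := holAt u γ₂ with hB_def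
  have hsplit : ∀ g : SU2, holAt (Function.update u b g) (γ₁ ++ ⟨b, f⟩ :: γ₂) = A * ((if f then g else g⁻¹) * B) := by
    intro g
    rw [holAt_append, holAt_cons, holAt_update_of_forall_ne u b g γ₁ h₁, holAt_update_of_forall_ne u b g γ₂ h₂, Function.update_self]
  cases f with
  | true =>
    refine ⟨su2Quat B * su2Quat A, by rw [norm_mul, norm_su2Quat, norm_su2Quat, mul_one], fun g => ?_⟩
    dsimp only
    rw [hsplit g, if_pos rfl, ← mul_assoc, reTr_conj_link, zero_add]
  | false =>
    refine ⟨star (su2Quat B * su2Quat A), by rw [norm_star, norm_mul, norm_su2Quat, norm_su2Quat, mul_one], fun g => ?_⟩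
    dsimp only
    rw [hsplit g, if_neg Bool.false_ne_true, ← mul_assoc, reTr_conj_link, su2Quat_inv, re_star_mul, zero_add]

/-- Hence **THE LEVEL SETS OF SUCH A LOOP VARIABLE ARE PRODUCT-HAAR-NULL**. [cite: Chatterjee2026YMHiggs, §3.2 (product Haar measure; Haar on SU(2) = uniform measure on S³)] -/
theorem fieldMeasure_loopLevel_eq_zero_of_split (γ₁ γ₂ : List (LStep P j)) (s : LStep P j)
    (h₁ : ∀ s' ∈ γ₁, s'.bond ≠ s.bond) (h₂ : ∀ s' ∈ γ₂, s'.bond ≠ s.bond) (t : ℝ) :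
    fieldMeasure P j SU2 {u | loopAt u (γ₁ ++ s :: γ₂) = t} = 0 := by
  classical
  refine fieldMeasure_level_eq_zero_of_linkAffine (measurable_loopAt _) s.bond (fun u => ?_) t
  obtain ⟨a, ha, hLA⟩ := linkAffine_reTr_holAt_split u γ₁ γ₂ s h₁ h₂
  exact ⟨0, a, fun h0 => by rw [h0, norm_zero] at ha; exact zero_ne_one ha, hLA⟩

end OnceVisited

/-! ## §2 No atoms for once-visiting labels: the original family, and the original string read on a refined unit field -/

section Atomless

variable (F : T3Family)

/-- **NO ATOMS under every unit law** (`SU(2)`, printed averaging, `γ ≥ 0`) for a label whose unit-lattice representative visits some bond exactly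
once. [cite: Balaban1985UV3, (2) p.256 + (6) p.257] -/
theorem unitLaw_loopLevel_eq_zero_of_split {γ : ℝ} (hγ : 0 ≤ γ) (K : ℕ) (C : ULoop3 F) (γ₁ γ₂ : List (LStep (F.P 0) 0))
    (s : LStep (F.P 0) 0) (hC : C.1.atLevel 0 = γ₁ ++ s :: γ₂) (h₁ : ∀ s' ∈ γ₁, s'.bond ≠ s.bond) (h₂ : ∀ s' ∈ γ₂, s'.bond ≠ s.bond)
    (t : ℝ) : F.unitLaw ℰp measurableE_ℰp γ K {u | loopAt u (C.1.atLevel 0) = t} = 0 := by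
  rw [T3UnitLawDensityEML.unitLaw_eq_withDensity_emlDensity F K hγ, hC]
  exact withDensity_absolutelyContinuous _ _ (fieldMeasure_loopLevel_eq_zero_of_split γ₁ γ₂ s h₁ h₂ t)

/-- **NO ATOMS for the coarse observable of a once-visiting label under the REFINED family's unit laws** (the proof of
`T3NontrivialityFromTiltRefine.refine_unitLaw_coarsePlaquetteLevel_eq_zero` with the plaquette nullity replaced by §1's). [cite: Balaban1985UV3, (2) p.256 + (6) p.257] -/
theorem refine_unitLaw_coarseLevel_eq_zero_of_split (n : ℕ) {γ' : ℝ} (hγ' : 0 ≤ γ') (K : ℕ) (C : ULoop3 F)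
    (γ₁ γ₂ : List (LStep (F.P 0) 0)) (s : LStep (F.P 0) 0) (hC : C.1.atLevel 0 = γ₁ ++ s :: γ₂)
    (h₁ : ∀ s' ∈ γ₁, s'.bond ≠ s.bond) (h₂ : ∀ s' ∈ γ₂, s'.bond ≠ s.bond) (t : ℝ) :
    (F.refine n).unitLaw ℰp measurableE_ℰp γ' K {u | coarseObs F n ℰp [C] u = t} = 0 := by
  rw [T3UnitLawDensityEML.unitLaw_eq_withDensity_emlDensity (F.refine n) K hγ']
  refine withDensity_absolutelyContinuous _ _ ?_
  have hmeas : ∀ j, Measurable (BlockAveraging.blockAvg (P := F.P n) (j := j) ℰp).avg :=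
    fun j => F.avgMeasurable_of_measurableE ℰp measurableE_ℰp n j
  set N : Set (GaugeField (F.P 0) 0 SU2) := {v | loopAt v (C.1.atLevel 0) = t} with hN_def
  have hN : MeasurableSet N := (measurable_loopAt _) (measurableSet_singleton t)
  have hN0 : fieldMeasure (F.P 0) 0 SU2 N = 0 := by
    rw [hN_def, hC]
    exact fieldMeasure_loopLevel_eq_zero_of_split γ₁ γ₂ s h₁ h₂ t
  set Φ : GaugeField (F.P n) 0 SU2 → GaugeField (F.P 0) 0 SU2 := fun U => unitShift F n
    (Averaging.iter (fun j => BlockAveraging.blockAvg (P := F.P n) (j := j) ℰp) n U) with hΦ_def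
  have hΦ : Measurable Φ := (measurable_unitShift F n).comp (measurable_iter _ hmeas n)
  have hset : {u : GaugeField ((F.refine n).P 0) 0 SU2 | coarseObs F n ℰp [C] u = t} =
      fieldShift (sitesPerDir_refine_unit F n) ⁻¹' (Φ ⁻¹' N) := by
    ext u
    rw [mem_setOf_eq, coarseObs_singleton, T3Family.avgObs_eq_loopAt_unitShift]
    rfl
  have key := (measurePreserving_fieldShift (G := SU2) (sitesPerDir_refine_unit F n)).measure_preimage
    ((hΦ hN).nullMeasurableSet)
  rw [hset]
  refine key.trans ?_
  change fieldMeasure (F.P n) 0 SU2 (Φ ⁻¹' N) = 0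
  rw [← Measure.map_apply hΦ hN]
  exact map_unitShift_iter_absolutelyContinuous F n hN0

end Atomless

/-! ## §3 (NT3) for every once-visiting label, from `UnitTiltTail` of the family or of a refinement -/

section NT3

variable {r w w' : ℕ → ℝ}

/-- **(NT3) FOR EVERY ONCE-VISITING LABEL, NO SMALLNESS**: `UnitTiltTail F ℰp γ r w w'` with summable rates gives `∃ c, UniformVariance (F.scheme ℰp γ) C c`
for every label `C` whose unit-lattice representative visits some bond exactly once. [cite: Chatterjee2019YMProbabilists, §6 p.19] -/
theorem exists_uniformVariance_of_unitTiltTail_of_split (F : T3Family) {γ : ℝ} (hγ : 0 ≤ γ) (h : UnitTiltTail F ℰp γ r w w')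
    (hr : Summable r) (hw : Summable w) (hw' : Summable w') (C : ULoop3 F) (γ₁ γ₂ : List (LStep (F.P 0) 0)) (s : LStep (F.P 0) 0)
    (hC : C.1.atLevel 0 = γ₁ ++ s :: γ₂) (h₁ : ∀ s' ∈ γ₁, s'.bond ≠ s.bond) (h₂ : ∀ s' ∈ γ₂, s'.bond ≠ s.bond) :
    ∃ c : ℝ, UniformVariance (F.scheme ℰp γ) C c := by
  obtain ⟨c, hc, hev⟩ := variance_eventually_ge_of_unitTiltTail measurableE_ℰp hγ h hr hw hw'
    (measurable_loopAt (C.1.atLevel 0)) (fun u => abs_loopAt_le_one u _)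
    (fun K a => unitLaw_loopLevel_eq_zero_of_split F hγ K C γ₁ γ₂ s hC h₁ h₂ a)
  refine ⟨c, hc, ?_⟩
  filter_upwards [hev] with K hK
  rw [expectAt_eq_integral_unitLaw measurableE_ℰp hγ K, expectAt_eq_integral_unitLaw measurableE_ℰp hγ K]
  simpa [pow_two] using hK

/-- **(NT3) FOR EVERY ONCE-VISITING LABEL FROM A REFINEMENT'S TILT**: `UnitTiltTail (F.refine n) ℰp (γL^{-n}) r w w'` with summable rates gives
`∃ c, UniformVariance (F.scheme ℰp γ) C c`. [cite: Chatterjee2019YMProbabilists, §6 p.19] -/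
theorem exists_uniformVariance_of_refine_unitTiltTail_of_split (F : T3Family) (n : ℕ) {γ : ℝ} (hγ : 0 ≤ γ)
    (h : UnitTiltTail (F.refine n) ℰp (γ * ((F.L : ℝ)⁻¹) ^ n) r w w') (hr : Summable r) (hw : Summable w) (hw' : Summable w')
    (C : ULoop3 F) (γ₁ γ₂ : List (LStep (F.P 0) 0)) (s : LStep (F.P 0) 0) (hC : C.1.atLevel 0 = γ₁ ++ s :: γ₂)
    (h₁ : ∀ s' ∈ γ₁, s'.bond ≠ s.bond) (h₂ : ∀ s' ∈ γ₂, s'.bond ≠ s.bond) :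
    ∃ c : ℝ, UniformVariance (F.scheme ℰp γ) C c := by
  have hγ' : 0 ≤ γ * ((F.L : ℝ)⁻¹) ^ n := mul_nonneg hγ (pow_nonneg (inv_nonneg.mpr (Nat.cast_nonneg _)) _)
  obtain ⟨c, hc, hev⟩ := variance_eventually_ge_of_unitTiltTail (F := F.refine n) measurableE_ℰp hγ' h hr hw hw'
    (measurable_coarseObs F n ℰp measurableE_ℰp [C]) (abs_coarseObs_le_one F n ℰp [C])
    (fun K a => refine_unitLaw_coarseLevel_eq_zero_of_split F n hγ' K C γ₁ γ₂ s hC h₁ h₂ a)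
  refine ⟨c, hc, ?_⟩
  obtain ⟨K₂, hK₂⟩ := eventually_atTop.1 hev
  refine eventually_atTop.2 ⟨K₂ + n, fun K' hK' => ?_⟩
  obtain ⟨d, rfl⟩ := Nat.exists_eq_add_of_le hK'
  have hK : K₂ ≤ K₂ + d := Nat.le_add_right _ _
  rw [show K₂ + n + d = (K₂ + d) + n by ring, expectAt_refine F n ℰp measurableE_ℰp hγ, expectAt_refine F n ℰp measurableE_ℰp hγ]
  simp_rw [coarseObs_pair]
  exact hK₂ (K₂ + d) hK

end NT3

/-! ## §4 The straight Polyakov label visits its first bond exactly once -/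

section Polyakov

variable {P : Params} {j : ℕ}

/-- The steps of the straight walk `(μ,+)^n` from `y` run over the bonds `⟨y + k e_μ, μ⟩`, `k < n`. [folklore] -/
private theorem mem_walk_replicate (μ : Fin P.d) :
    ∀ (n : ℕ) (y : Site P j) (s' : LStep P j), s' ∈ walk y (List.replicate n (μ, true)) →
      ∃ k : ℕ, k < n ∧ s'.bond = ⟨Function.update y μ (y μ + k), μ⟩
  | 0, y, s', hs' => by simp [walk] at hs'
  | n + 1, y, s', hs' => by
    rw [List.replicate_succ] at hs'
    change s' ∈ (⟨⟨y, μ⟩, true⟩ :: walk (y.shift μ) (List.replicate n (μ, true))) at hs'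
    rcases List.mem_cons.1 hs' with rfl | hmem
    · exact ⟨0, Nat.succ_pos n, by simp⟩
    · obtain ⟨k, hk, hb⟩ := mem_walk_replicate μ n (y.shift μ) s' hmem
      refine ⟨k + 1, by omega, ?_⟩
      rw [hb, Site.shift, Function.update_idem, Function.update_self, Nat.cast_add, Nat.cast_one]
      congr 2
      ring

variable {F : T3Family}

/-- The unit torus has `2L^m` sites per direction (local copy; gate dedup). [cite: Balaban1985UV3, (1)-(3) p.256] -/
private theorem sitesPerDir_unit_eq (F : T3Family) : (F.P 0).sitesPerDir 0 = 2 * F.L ^ F.m := by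
  simp [Params.sitesPerDir]

/-- **THE STRAIGHT POLYAKOV LABEL VISITS ITS FIRST BOND EXACTLY ONCE**: `(polyakov μ x).atLevel 0 = [] ++ ⟨⟨x, μ⟩, +⟩ :: γ₂` with `⟨x, μ⟩ ∉ γ₂`
(the later bonds start at `x + k e_μ`, `1 ≤ k < 2L^m`). [cite: McLerranSvetitsky1981] -/
theorem polyakov_atLevel_split (μ : Fin 3) (x : F.USite) :
    ∃ γ₂ : List (LStep (F.P 0) 0),
      (ULoop3.polyakov μ x).1.atLevel 0 = [] ++ ⟨⟨F.toLevel 0 x, μ⟩, true⟩ :: γ₂ ∧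
      ∀ s' ∈ γ₂, s'.bond ≠ ⟨F.toLevel 0 x, μ⟩ := by
  set y : Site (F.P 0) 0 := F.toLevel 0 x with hy_def
  have hN : 2 ≤ 2 * F.L ^ F.m := by
    have := F.hL.2
    have : 1 ≤ F.L ^ F.m := Nat.one_le_pow _ _ (by omega)
    omega
  obtain ⟨N', hN'⟩ : ∃ N', 2 * F.L ^ F.m = N' + 1 := ⟨2 * F.L ^ F.m - 1, by omega⟩
  refine ⟨walk (y.shift μ) (List.replicate N' (μ, true)), ?_, fun s' hs' => ?_⟩
  · show walk y (List.replicate (2 * F.L ^ F.m) (μ, true)) = _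
    rw [hN', List.replicate_succ, List.nil_append]
    rfl
  · obtain ⟨k, hk, hb⟩ := mem_walk_replicate μ N' (y.shift μ) s' hs'
    rw [hb]
    intro heq
    have h1 : y μ + ((1 : ZMod ((F.P 0).sitesPerDir 0)) + k) = y μ + 0 := by
      rw [add_zero, ← add_assoc]
      have := congrFun (congrArg PBond.src heq) μ
      simp only [Function.update_self, Site.shift] at this
      exact this
    -- `1 + k = 0` in `ZMod (2L^m)` with `1 ≤ 1 + k ≤ N' < 2L^m`: impossible
    have hzero : ((1 + k : ℕ) : ZMod ((F.P 0).sitesPerDir 0)) = 0 := by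
      push_cast
      exact add_left_cancel h1
    rw [ZMod.natCast_eq_zero_iff, sitesPerDir_unit_eq] at hzero
    have := Nat.le_of_dvd (by omega) hzero
    omega

/-- **(NT3) FOR THE POLYAKOV LABELS, NO SMALLNESS** (gen 6's `uniformVariance_polyakov_of_smallMass` freed of its mass condition, at the price of
an inexplicit constant): `UnitTiltTail F ℰp γ r w w'` with summable rates ⇒ `∃ c, UniformVariance (F.scheme ℰp γ) (polyakov μ x) c`.
[cite: Chatterjee2019YMProbabilists, §6 p.19] -/
theorem exists_uniformVariance_polyakov_of_unitTiltTail (F : T3Family) {γ : ℝ} (hγ : 0 ≤ γ) {r w w' : ℕ → ℝ}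
    (h : UnitTiltTail F ℰp γ r w w') (hr : Summable r) (hw : Summable w) (hw' : Summable w') (μ : Fin 3) (x : F.USite) :
    ∃ c : ℝ, UniformVariance (F.scheme ℰp γ) (ULoop3.polyakov μ x) c := by
  obtain ⟨γ₂, hC, h₂⟩ := polyakov_atLevel_split μ x
  exact exists_uniformVariance_of_unitTiltTail_of_split F hγ h hr hw hw' _ [] γ₂ _ hC (fun s' hs' => by simp at hs') h₂

/-- The same from a refinement's tilt: `UnitTiltTail (F.refine n) ℰp (γL^{-n}) r w w'` ⇒ `∃ c, UniformVariance (F.scheme ℰp γ) (polyakov μ x) c`.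
[cite: Chatterjee2019YMProbabilists, §6 p.19] -/
theorem exists_uniformVariance_polyakov_of_refine_unitTiltTail (F : T3Family) (n : ℕ) {γ : ℝ} (hγ : 0 ≤ γ) {r w w' : ℕ → ℝ}
    (h : UnitTiltTail (F.refine n) ℰp (γ * ((F.L : ℝ)⁻¹) ^ n) r w w') (hr : Summable r) (hw : Summable w) (hw' : Summable w')
    (μ : Fin 3) (x : F.USite) :
    ∃ c : ℝ, UniformVariance (F.scheme ℰp γ) (ULoop3.polyakov μ x) c := by
  obtain ⟨γ₂, hC, h₂⟩ := polyakov_atLevel_split μ x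
  exact exists_uniformVariance_of_refine_unitTiltTail_of_split F n hγ h hr hw hw' _ [] γ₂ _ hC (fun s' hs' => by simp at hs') h₂

end Polyakov

end Literature.MathematicalPhysics.QuantumFieldTheory.Balaban1983to89.T3NontrivialityFromTiltLabels

end
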